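import Mathlib
import Literature.AlgebraicGeometry.Resolution.CobordantGame
import Literature.AlgebraicGeometry.Resolution.CobordantChartCoefficients
import Literature.AlgebraicGeometry.Resolution.CobordantChartPlaneSlice
import Literature.AlgebraicGeometry.Resolution.CobordantTupleGame
import Literature.AlgebraicGeometry.Resolution.CobordantArcLemma
import Literature.AlgebraicGeometry.Resolution.FormalCoordinateChange
import Summits.ResolutionOfSingularities.ResolutionOfSingularities.Theorems.WeightedInvariantLocalWeightedDropSliceChart
import Summits.ResolutionOfSingularities.ResolutionOfSingularities.Theorems.WeightedInvariantLocalWeightedDropMonicCurveBlowup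

/-!
# `WeightedInvariant.LocalWeightedDrop`: toolkit for the TERMINAL double points `y² + A₀(x₀, …, x_m)` in EVERY dimension

Crux item stmt-ResolutionOfSingularities-8899 `LocalWeightedDrop` (route `ResolutionOfSingularities/WeightedInvariant`), skeleton v29,
residual stubs W4|₄ `stub_wildWideApexFourStartsWon` / W4|₅₊ `stub_wildWideApexFiveUpStartsWon` (the `d = 2` slice: char-2 double
points in `≥ 4` variables, cut to monic double points by `wildWideApexHigherStartsWon_two_of_monicForms`).  [OURS · L1 W4.3, chain w43,
stub worker 4 (gen 4): the dimension-generic twin of stub worker 3's `TerminalDoublePoint` toolkit (`m = 2` only); NOT a statement of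
any manuscript.]

Contents (every field `k`; the curve step in every characteristic `p`; old variables `x₀, …, x_m`, `y = X (Fin.last (m+1))`,
`A₀` embedded along `Fin.succAboveEmb (Fin.last (m+1))`):
* coefficients of `y² + A₀` in the old variables (`coeff_embDomain_dp`, `coeff_single_castSucc_dp`); `y² + A₀` is not singular as
  soon as `A₀` has a linear term (`not_isSingular_dp_of_coeff_ne_zero`);
* unit monomials `x^μ · U` (`constantCoeff_prod_X_pow_eq_zero`, `prod_X_pow_eq_X_of_single`);
* THE COMPOSITE «blow up `V(x_i, y)`, pass to the exceptional point `c_i = c`, slice `x_i' ↦ 0`» on the old variables IS the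
  linear substitution `ρ_i(c) : x_i ↦ c · x₀, x_l ↦ x_{π l}` with `π = Fin.cycleRange i` (`slice_subst_chart`, `rho_eq`), and its
  action on unit monomials (`subst_rho_prod_X_pow_mul`: `x^μ U ↦ x^{μ ∘ π⁻¹} · c^{μ_i} U(ρ)`), on constant terms and on linear
  coefficients (`constantCoeff_subst_rho`, `coeff_single_cycleRange_subst_rho`);
* THE CURVE STEP `won_dp_of_curveStep` (dimension-generic): if `A₀ = x_i² · A₀'` with `A₀'(0) = 0`, then `y² + A₀` is won as soon
  as every SINGULAR slice `y² + c² · A₀'(ρ_i(c))` (`c ≠ 0`) is won (`won_monic_of_curveBlowup`, weights `1` at `x_i`, `y`).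
-/

set_option linter.dupNamespace false -- mandated namespace of this single-conjunct summit

namespace Summit.ResolutionOfSingularities.ResolutionOfSingularities.Theorems

open Literature.AlgebraicGeometry.Resolution
open Literature.AlgebraicGeometry.Resolution.CobordantGame

namespace TerminalDoublePointDim

open MvPowerSeries

variable {k : Type} [Field k] {m : ℕ}

/-! ### Coefficients of `y² + A₀(x₀, …, x_m)` in the old variables -/

/-- Exponents of the old variables, embedded along `Fin.succAbove (Fin.last (m+1))`: `x_l^n ↦ X_{castSucc l}^n`. -/
theorem embDomain_single (l : Fin (m + 1)) (n : ℕ) :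
    Finsupp.embDomain (Fin.succAboveEmb (Fin.last (m + 1))) (Finsupp.single l n) = Finsupp.single (Fin.castSucc l) n := by
  rw [Finsupp.embDomain_single, Fin.coe_succAboveEmb, Fin.succAbove_last]

/-- The coefficient of `y² + A₀` at a `y`-free exponent `x^β` is the coefficient of `A₀` at `β`. -/
theorem coeff_embDomain_dp (A₀ : MvPowerSeries (Fin (m + 1)) k) (β : Fin (m + 1) →₀ ℕ) :
    coeff (Finsupp.embDomain (Fin.succAboveEmb (Fin.last (m + 1))) β)
        (X (Fin.last (m + 1)) ^ 2 + rename (Fin.succAboveEmb (Fin.last (m + 1))) A₀) = coeff β A₀ := by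
  classical
  rw [map_add, coeff_embDomain_rename, coeff_X_pow, if_neg, zero_add]
  intro h
  have h2 := congrArg (fun e => e (Fin.last (m + 1))) h
  simp only [Finsupp.single_eq_same] at h2
  rw [Finsupp.embDomain_notin_range _ _ _ (by simp)] at h2
  exact absurd h2 (by norm_num)

/-- The coefficient of `y² + A₀` at `x_l^n` is the coefficient of `A₀` at `x_l^n`. -/
theorem coeff_single_castSucc_dp (A₀ : MvPowerSeries (Fin (m + 1)) k) (l : Fin (m + 1)) (n : ℕ) :
    coeff (Finsupp.single (Fin.castSucc l) n) (X (Fin.last (m + 1)) ^ 2 + rename (Fin.succAboveEmb (Fin.last (m + 1))) A₀) =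
      coeff (Finsupp.single l n) A₀ := by
  rw [← embDomain_single, coeff_embDomain_dp]

/-- `y² + A₀` is NOT singular as soon as `A₀` has a non-zero linear coefficient. -/
theorem not_isSingular_dp_of_coeff_ne_zero {A₀ : MvPowerSeries (Fin (m + 1)) k} (l : Fin (m + 1))
    (h : coeff (Finsupp.single l 1) A₀ ≠ 0) :
    ¬ CobordantGame.IsSingular k (X (Fin.last (m + 1)) ^ 2 + rename (Fin.succAboveEmb (Fin.last (m + 1))) A₀) := by
  intro hS
  apply h
  rw [← coeff_single_castSucc_dp A₀ l 1]
  exact hS.2.2 _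

/-- `y² + A₀` as the monic form `y² + Σ_{j<2} (![A₀, 0] j) y^j` of the monic bricks. -/
theorem dp_eq_sum (A₀ : MvPowerSeries (Fin (m + 1)) k) :
    X (Fin.last (m + 1)) ^ 2 + rename (Fin.succAboveEmb (Fin.last (m + 1))) A₀ =
      X (Fin.last (m + 1)) ^ 2 + ∑ j : Fin 2, rename (Fin.succAboveEmb (Fin.last (m + 1)))
        ((![A₀, 0] : Fin 2 → MvPowerSeries (Fin (m + 1)) k) j) * X (Fin.last (m + 1)) ^ (j : ℕ) := by
  rw [Fin.sum_univ_two]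
  simp

/-! ### Unit monomials `x^μ · U` -/

/-- A monomial with a positive exponent vanishes at the origin. -/
theorem constantCoeff_prod_X_pow_eq_zero (μ : Fin (m + 1) → ℕ) {l : Fin (m + 1)} (hl : 0 < μ l) :
    constantCoeff (∏ j, (X j : MvPowerSeries (Fin (m + 1)) k) ^ μ j) = 0 := by
  rw [map_prod]
  exact Finset.prod_eq_zero (Finset.mem_univ l) (by rw [map_pow, constantCoeff_X, zero_pow hl.ne'])

/-- A monomial all of whose exponents but `μ_l = 1` vanish is `x_l`. -/
theorem prod_X_pow_eq_X_of_single (μ : Fin (m + 1) → ℕ) (l : Fin (m + 1)) (hl : μ l = 1) (hoff : ∀ j, j ≠ l → μ j = 0) :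
    (∏ j, (X j : MvPowerSeries (Fin (m + 1)) k) ^ μ j) = X l := by
  rw [Finset.prod_eq_single l (fun j _ hj => by rw [hoff j hj, pow_zero]) (fun h => absurd (Finset.mem_univ l) h), hl,
    pow_one]

/-- The linear coefficient of `x_l · U` at `x_l` is `U(0)`. -/
theorem coeff_single_X_mul (l : Fin (m + 1)) (U : MvPowerSeries (Fin (m + 1)) k) :
    coeff (Finsupp.single l 1) (X l * U) = constantCoeff U := by
  classical
  rw [X_def, coeff_monomial_mul, if_pos le_rfl, tsub_self, one_mul, coeff_zero_eq_constantCoeff_apply]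

/-! ### The composite «curve chart, then slice» is the linear substitution `ρ_i(c)` -/

/-- `ρ_i(c)` has zero constant terms. -/
theorem constantCoeff_rho (i : Fin (m + 1)) (c : k) (l : Fin (m + 1)) :
    constantCoeff ((fun l : Fin (m + 1) => if l = i then C c * X 0
      else (X (Fin.predAbove i l.succ) : MvPowerSeries (Fin (m + 1)) k)) l) = 0 := by
  dsimp only
  split_ifs <;> simp [constantCoeff_X]

/-- `ρ_i(c)` is substitutable. -/
theorem hasSubst_rho (i : Fin (m + 1)) (c : k) :
    HasSubst (fun l : Fin (m + 1) => if l = i then C c * X 0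
      else (X (Fin.predAbove i l.succ) : MvPowerSeries (Fin (m + 1)) k)) :=
  hasSubst_of_constantCoeff_zero (constantCoeff_rho i c)

/-- THE COMPOSITE «blow up `V(x_i, y)`, go to the exceptional point `c_i = c`, slice `x_i' ↦ 0`» on the old variables IS the
substitution `x_i ↦ c · x₀`, `x_l ↦ x_{predAbove i (l+1)}` (the exceptional variable `s` becomes `x₀`). -/
theorem slice_subst_chart (i : Fin (m + 1)) (c : k) (F : MvPowerSeries (Fin (m + 1)) k) :
    TupleGame.slice i (subst (CobordantChart.chart (fun l : Fin (m + 1) => if l = i then 1 else 0)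
        (fun l : Fin (m + 1) => if l = i then c else 0)) F) =
      subst (fun l : Fin (m + 1) => if l = i then C c * X 0
        else (X (Fin.predAbove i l.succ) : MvPowerSeries (Fin (m + 1)) k)) F := by
  have hc : ∀ l : Fin (m + 1), (fun l : Fin (m + 1) => if l = i then (1 : ℕ) else 0) l = 0 →
      (fun l : Fin (m + 1) => if l = i then c else 0) l = 0 := by
    intro l hl
    dsimp only at hl ⊢
    by_cases h : l = i
    · rw [if_pos h] at hl
      exact absurd hl one_ne_zero
    · rw [if_neg h]
  have hch := CobordantChart.hasSubst_chart _ _ hc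
  have hsl := CobordantChartPlaneSlice.hasSubst_slice (R := k) (n := m + 1) i
  unfold TupleGame.slice
  rw [subst_comp_subst_apply hch hsl]
  congr 1
  funext l
  rw [SliceChart.subst_slice_chart]
  by_cases hl : l = i
  · subst hl
    simp only [if_true, pow_one, add_zero]
    ring
  · simp only [if_neg hl, pow_zero, one_mul, map_zero, zero_add]

/-- The slot permutation behind `ρ_i(c)`: `predAbove i (l+1) = cycleRange i l` for `l ≠ i` (the cycle `(0 1 … i)`). -/
theorem predAbove_succ_eq_cycleRange (i l : Fin (m + 1)) (h : l ≠ i) : Fin.predAbove i l.succ = Fin.cycleRange i l := by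
  rcases lt_or_gt_of_ne h with hlt | hgt
  · rw [Fin.predAbove_of_le_castSucc _ _ (by rw [Fin.le_castSucc_iff]; exact Fin.succ_lt_succ_iff.mpr hlt)]
    ext
    rw [Fin.coe_castPred, Fin.val_succ, Fin.coe_cycleRange_of_lt hlt]
  · rw [Fin.predAbove_of_castSucc_lt _ _ (by rw [Fin.castSucc_lt_iff_succ_le]; exact Fin.succ_le_succ_iff.mpr hgt.le),
      Fin.pred_succ, Fin.cycleRange_of_gt hgt]

/-- `ρ_i(c)` slot by slot: `x_l ↦ a_l · x_{π l}` with `π = Fin.cycleRange i`, `a_i = c`, `a_l = 1` otherwise. -/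
theorem rho_eq (i : Fin (m + 1)) (c : k) (l : Fin (m + 1)) :
    (if l = i then C c * X 0 else (X (Fin.predAbove i l.succ) : MvPowerSeries (Fin (m + 1)) k)) =
      C (if l = i then c else 1) * X (Fin.cycleRange i l) := by
  by_cases hl : l = i
  · rw [if_pos hl, if_pos hl, hl, Fin.cycleRange_self]
  · rw [if_neg hl, if_neg hl, map_one, one_mul, predAbove_succ_eq_cycleRange i l hl]

/-- `ρ_i(c)` ON A UNIT MONOMIAL: `(x^μ · U)(ρ_i(c)) = x^{μ ∘ π⁻¹} · (c^{μ_i} · U(ρ_i(c)))`, `π = Fin.cycleRange i`. -/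
theorem subst_rho_prod_X_pow_mul (i : Fin (m + 1)) (c : k) (μ : Fin (m + 1) → ℕ) (U : MvPowerSeries (Fin (m + 1)) k) :
    subst (fun l : Fin (m + 1) => if l = i then C c * X 0
        else (X (Fin.predAbove i l.succ) : MvPowerSeries (Fin (m + 1)) k)) ((∏ l, X l ^ μ l) * U) =
      (∏ l, X l ^ μ ((Fin.cycleRange i).symm l)) *
        (C (c ^ μ i) * subst (fun l : Fin (m + 1) => if l = i then C c * X 0
          else (X (Fin.predAbove i l.succ) : MvPowerSeries (Fin (m + 1)) k)) U) := by
  have hs := hasSubst_rho (k := k) i c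
  rw [← coe_substAlgHom hs, map_mul, map_prod]
  simp only [map_pow, coe_substAlgHom, subst_X hs]
  have hfac : ∀ l : Fin (m + 1), (if l = i then C c * X 0
      else (X (Fin.predAbove i l.succ) : MvPowerSeries (Fin (m + 1)) k)) ^ μ l =
      C ((if l = i then c else 1) ^ μ l) * X (Fin.cycleRange i l) ^ μ l := fun l => by
    rw [rho_eq, mul_pow, map_pow]
  rw [Finset.prod_congr rfl fun l _ => hfac l, Finset.prod_mul_distrib, ← map_prod,
    Finset.prod_eq_single i (fun l _ hl => by rw [if_neg hl, one_pow]) (fun h => absurd (Finset.mem_univ i) h), if_pos rfl,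
    ← Equiv.prod_comp (Fin.cycleRange i) (fun l => (X l : MvPowerSeries (Fin (m + 1)) k) ^ μ ((Fin.cycleRange i).symm l))]
  simp only [Equiv.symm_apply_apply, map_pow]
  ring

/-- `ρ_i(c)` does not change constant terms. -/
theorem constantCoeff_subst_rho (i : Fin (m + 1)) (c : k) (U : MvPowerSeries (Fin (m + 1)) k) :
    constantCoeff (subst (fun l : Fin (m + 1) => if l = i then C c * X 0
      else (X (Fin.predAbove i l.succ) : MvPowerSeries (Fin (m + 1)) k)) U) = constantCoeff U :=
  constantCoeff_subst_of_constantCoeff_zero _ (constantCoeff_rho i c) U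

/-- `ρ_i(c)` at the zero series is zero. -/
theorem subst_rho_zero (i : Fin (m + 1)) (c : k) :
    subst (fun l : Fin (m + 1) => if l = i then C c * X 0
      else (X (Fin.predAbove i l.succ) : MvPowerSeries (Fin (m + 1)) k)) (0 : MvPowerSeries (Fin (m + 1)) k) = 0 := by
  rw [← coe_substAlgHom (hasSubst_rho i c), map_zero]

/-- LINEAR COEFFICIENTS UNDER `ρ_i(c)`: `[x_{π l₀}] g(ρ_i(c)) = a_{l₀} · [x_{l₀}] g` (`a_i = c`, `a_l = 1` otherwise). -/
theorem coeff_single_cycleRange_subst_rho (i : Fin (m + 1)) (c : k) (l₀ : Fin (m + 1)) (g : MvPowerSeries (Fin (m + 1)) k) :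
    coeff (Finsupp.single (Fin.cycleRange i l₀) 1) (subst (fun l : Fin (m + 1) => if l = i then C c * X 0
      else (X (Fin.predAbove i l.succ) : MvPowerSeries (Fin (m + 1)) k)) g) =
      (if l₀ = i then c else 1) * coeff (Finsupp.single l₀ 1) g := by
  classical
  rw [CobordantArc.coeff_degree_one_subst _ (constantCoeff_rho i c) g _ (Finsupp.degree_single _ _)]
  rw [Finset.sum_eq_single l₀]
  · rw [rho_eq, coeff_C_mul, coeff_X, if_pos rfl, mul_one, mul_comm]
  · intro l _ hl
    have hne : Finsupp.single (Fin.cycleRange i l₀) 1 ≠ Finsupp.single (Fin.cycleRange i l) 1 := fun h =>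
      hl ((Fin.cycleRange i).injective ((Finsupp.single_left_inj one_ne_zero).mp h)).symm
    rw [rho_eq, coeff_C_mul, coeff_X, if_neg hne, mul_zero, mul_zero]
  · intro h
    exact absurd (Finset.mem_univ l₀) h

/-! ### The curve step on `y² + A₀` (every dimension) -/

/-- THE CURVE STEP.  If `A₀ = x_i² · A₀'` with `A₀'(0) = 0`, blowing up `V(x_i, y)` (`won_monic_of_curveBlowup`, weights `1` at
`x_i` and `y`, every exceptional point tame) wins `y² + A₀` as soon as every SINGULAR slice `y² + c² · A₀'(ρ_i(c))` (`c ≠ 0`) is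
won. -/
theorem won_dp_of_curveStep (p : ℕ) (hp : p.Prime) (k : Type) [Field k] [CharP k p] {m : ℕ} (i : Fin (m + 1))
    (A₀ A₀' : MvPowerSeries (Fin (m + 1)) k) (hdiv : A₀ = X i ^ 2 * A₀') (h0 : constantCoeff A₀' = 0)
    (hsucc : ∀ c : k, c ≠ 0 →
      CobordantGame.IsSingular k (X (Fin.last (m + 1)) ^ 2 + rename (Fin.succAboveEmb (Fin.last (m + 1)))
        (C (c ^ 2) * subst (fun l : Fin (m + 1) => if l = i then C c * X 0
          else (X (Fin.predAbove i l.succ) : MvPowerSeries (Fin (m + 1)) k)) A₀')) →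
      CobordantGame.Won k (m + 1 + 1) (X (Fin.last (m + 1)) ^ 2 + rename (Fin.succAboveEmb (Fin.last (m + 1)))
        (C (c ^ 2) * subst (fun l : Fin (m + 1) => if l = i then C c * X 0
          else (X (Fin.predAbove i l.succ) : MvPowerSeries (Fin (m + 1)) k)) A₀'))) :
    CobordantGame.Won k (m + 1 + 1) (X (Fin.last (m + 1)) ^ 2 + rename (Fin.succAboveEmb (Fin.last (m + 1))) A₀) := by
  classical
  rw [dp_eq_sum]
  refine won_monic_of_curveBlowup p hp k (m + 1) 2 two_pos i (![A₀, 0]) (![A₀', 0]) ?_ ?_ ?_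
  · intro j
    fin_cases j
    · simpa using hdiv
    · simp
  · intro j
    fin_cases j
    · simpa using h0
    · simp
  · intro c hc hS
    have hSeq : X (Fin.last (m + 1)) ^ 2 + ∑ j : Fin 2, rename (Fin.succAboveEmb (Fin.last (m + 1)))
        (C (c ^ (2 - (j : ℕ))) * TupleGame.slice i (subst (CobordantChart.chart (fun l : Fin (m + 1) => if l = i then 1 else 0)
          (fun l : Fin (m + 1) => if l = i then c else 0)) ((![A₀', 0] : Fin 2 → MvPowerSeries (Fin (m + 1)) k) j))) *
          X (Fin.last (m + 1)) ^ (j : ℕ) =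
        X (Fin.last (m + 1)) ^ 2 + rename (Fin.succAboveEmb (Fin.last (m + 1)))
          (C (c ^ 2) * subst (fun l : Fin (m + 1) => if l = i then C c * X 0
            else (X (Fin.predAbove i l.succ) : MvPowerSeries (Fin (m + 1)) k)) A₀') := by
      rw [Fin.sum_univ_two]
      simp only [Matrix.cons_val_zero, Matrix.cons_val_one, Fin.val_zero, Fin.val_one,
        Nat.sub_zero, pow_zero, mul_one, slice_subst_chart, subst_rho_zero, mul_zero, map_zero, zero_mul, add_zero]
    rw [hSeq] at hS ⊢
    exact hsucc c hc hS

end TerminalDoublePointDim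

end Summit.ResolutionOfSingularities.ResolutionOfSingularities.Theorems
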